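import Literature.MathematicalPhysics.QuantumLattice.HubbardFermiSurfaceSmearing
import Summits.HubbardSuperconductivity.HubbardLadder.HubbardDopedMomentRows
import HarnessLib

/-!
# R2 rows (device D25): the `U′ = 12` lever at `N = 14`, `U = 8` — parametric rows awaiting ONE certificate

HONEST FRAMING: ladder R1–R4 with certified numbers; no claim on H/H₀.

Object: normalised ground states `ψ` of the doped pure Hubbard model `hamiltonian (fermionTorusGraph 2 4) 1 8`
on the `4 × 4` torus, `N = 14` (`n = 7/8`, the H line's filling, `t′ = 0`). Today every LOWER edge of the
double occupancy there is `d ≥ 0` (operator positivity: R2-TABLE row C1d, `doubleOcc_four_N14_U8_mem_Icc_of_claims`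
gives `d ∈ [0, 0.0742]`), because no energy certificate exists at any `U′ > 8` on the `N = 14` sector; for the
same reason the kinetic energy has only the trivial ceiling `K ≤ E_14(8)`, the local moment only `m_loc ≤ 7/8`,
and the Fermi-surface smearing (device D24) only `W_0 ≤ E_14(8) + 24`.

Device (the typed shape the cell lead asked for, LEAD LINE (Q) 2026-08-20: named GO `engA-secrows1-N14.EU12` =
ONE energy LOWER certificate `E₁₂ ≤ E_14(t=1, U′=12)`): by the supergradient inequality of the concave
`U ↦ E_14(U)` at a `U = 8` ground state (`groundEnergyAt_sub_le_mul_doubleOcc`, Koma–Tasaki 1994 §1),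
`E_14(12) - E_14(8) ≤ 4 ⟨ψ, D ψ⟩`, so with the LANDED Rayleigh upper node `torusUpper_mbbootE2_4x4_U8_N14`
(`E_14(8) ≤ u₈ := -815606355579/2³⁶ ≈ -11.8686345`) every lower bound `E₁₂` yields, per site,
* `d ≥ (E₁₂ - u₈)/64` (`doubleOcc_four_N14_U8_ge_of_lower12`),
* `k = Re⟨ψ,H₀ψ⟩/16 ≤ (3u₈ - 2E₁₂)/16` (`kineticPerSite_four_N14_U8_le_of_lower12`; `K = E - 8⟨D⟩`),
* bond-averaged hopping amplitude `≥ -(3u₈ - 2E₁₂)/128` (`bondAvg_four_N14_U8_mem_Icc_of_lower12`),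
* `m_loc ≤ 7/8 - (E₁₂ - u₈)/32` (`localMoment_four_N14_U8_le_of_lower12`),
* Fermi-surface smearing `W_0 ≤ 3u₈ - 2E₁₂ + 24`, displaced electrons `dev ≤ (3u₈ - 2E₁₂ + 24)/2`,
  `nInside ≥ 14 - (3u₈ - 2E₁₂ + 24)/2`, corner pair `h_Γ + n_Q ≤ (3u₈ - 2E₁₂ + 24)/4`
  (`smearing_four_N14_U8_le_of_lower12`, `occupationRows_four_N14_U8_of_lower12`, kernel `FermiSmearing`).
All parametric in the real number `E₁₂` under the hypothesis `E₁₂ ≤ groundEnergyAt (fermionTorusGraph 2 4) 1 12 14`;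
when a typed node `… : Prop := (c : ℝ) ≤ groundEnergyAt (fermionTorusGraph 2 4) 1 12 14` lands in `Bounds/`, its
`_ge_of_claim` lemma is the argument `hL` and the numeric rows follow by `norm_num`. ILLUSTRATION ONLY (no such
certificate exists today; the threshold `-10` is a HYPOTHETICAL value chosen to show the constants flowing, not a
prediction): `E₁₂ = -10` would give `d ≥ 0.0291`, `k ≤ -0.9753`, `m_loc ≤ 0.8167`, `dev ≤ 4.1971`, `nInside ≥ 9.8029`
(`illustration_four_N14_U8_of_minus_ten_le`). The lever is informative iff `E₁₂ > u₈` (positive `d`-edge) and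
beats the present `k`/`m_loc`/`W_0` ceilings iff `E₁₂ > u₈` as well; it can never contradict row C1d unless
`E₁₂ > u₈ + 64·0.0742`, which would refute one of the two certificates (consistency clause).

Every certificate is an OPEN obligation BY NAME (hypothesis). No sorry. WEAK label (ED-able cluster).
-/

noncomputable section

namespace Summit.HubbardSuperconductivity.HubbardLadder

open Literature.MathematicalPhysics.QuantumLattice Literature.Probability.LatticeModels Matrix
open Literature.MathematicalPhysics.QuantumLattice.FermiSmearing DoubleOccupancy Bounds

/-- **Double-occupancy floor from a `U′ = 12` lower bound** (`N = 14`, `U = 8`; exact-hypothesis form):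
`E_14(8) ≤ u₈` and `E₁₂ ≤ E_14(12)` give `d ≥ (E₁₂ - u₈)/64`. [cite: KomaTasaki1994, §1] -/
theorem doubleOcc_four_N14_U8_ge_of_lower12 {ψ : Fock (Orb (FermionTorus 2 4))}
    (hψ : IsGroundState (hamiltonian (fermionTorusGraph 2 4) 1 8) 14 ψ) (hψ1 : star ψ ⬝ᵥ ψ = 1) {E₁₂ : ℝ}
    (hR : groundEnergyAt (fermionTorusGraph 2 4) 1 8 14 ≤ (-815606355579 : ℝ) / 2 ^ 36)
    (hL : E₁₂ ≤ groundEnergyAt (fermionTorusGraph 2 4) 1 12 14) :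
    (E₁₂ - (-815606355579 : ℝ) / 2 ^ 36) / 64 ≤
      (expect (∑ x : FermionTorus 2 4, numberOp x 0 * numberOp x 1) ψ).re / 16 := by
  have h := groundEnergyAt_sub_le_mul_doubleOcc (fermionTorusGraph 2 4) 1 8 12 hψ hψ1
  norm_num at h
  linarith

/-- **Double-occupancy floor, claim form in the `U = 8` node** (`torusUpper_mbbootE2_4x4_U8_N14`), parametric in
the `U′ = 12` lower bound `E₁₂`. [cite: KomaTasaki1994, §1] -/
theorem doubleOcc_four_N14_U8_ge_of_claim_of_lower12 {ψ : Fock (Orb (FermionTorus 2 4))}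
    (hψ : IsGroundState (hamiltonian (fermionTorusGraph 2 4) 1 8) 14 ψ) (hψ1 : star ψ ⬝ᵥ ψ = 1) {E₁₂ : ℝ}
    (h₈ : torusUpper_mbbootE2_4x4_U8_N14) (hL : E₁₂ ≤ groundEnergyAt (fermionTorusGraph 2 4) 1 12 14) :
    (E₁₂ - (-815606355579 : ℝ) / 2 ^ 36) / 64 ≤
      (expect (∑ x : FermionTorus 2 4, numberOp x 0 * numberOp x 1) ψ).re / 16 :=
  doubleOcc_four_N14_U8_ge_of_lower12 hψ hψ1 (groundEnergyAt_4x4_U8_N14_le_of_claim h₈) hL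

/-- **Kinetic-energy ceiling from a `U′ = 12` lower bound**: `k ≤ (3u₈ - 2E₁₂)/16`
(`K = E_14(8) - 8⟨D⟩ ≤ E_14(8) - 2(E_14(12) - E_14(8))`). [cite: KomaTasaki1994, §1] -/
theorem kineticPerSite_four_N14_U8_le_of_lower12 {ψ : Fock (Orb (FermionTorus 2 4))}
    (hψ : IsGroundState (hamiltonian (fermionTorusGraph 2 4) 1 8) 14 ψ) (hψ1 : star ψ ⬝ᵥ ψ = 1) {E₁₂ : ℝ}
    (h₈ : torusUpper_mbbootE2_4x4_U8_N14) (hL : E₁₂ ≤ groundEnergyAt (fermionTorusGraph 2 4) 1 12 14) :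
    (expect (hamiltonian (fermionTorusGraph 2 4) 1 0) ψ).re / 16 ≤
      (3 * ((-815606355579 : ℝ) / 2 ^ 36) - 2 * E₁₂) / 16 := by
  have hK := re_expect_kinetic_eq (fermionTorusGraph 2 4) 1 8 hψ hψ1
  have hD := groundEnergyAt_sub_le_mul_doubleOcc (fermionTorusGraph 2 4) 1 8 12 hψ hψ1
  have hE := groundEnergyAt_4x4_U8_N14_le_of_claim h₈
  norm_num at hD
  rw [hK]
  linarith

/-- **Bond-averaged hopping amplitude from a `U′ = 12` lower bound**:
`Re(Σ_σ Σ_{x∼y} ⟨c†_{xσ}c_{yσ}⟩)/128 ∈ [-(3u₈ - 2E₁₂)/128, 3/16]` (upper end = the free value).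
[cite: LiebLossMccann1993, Theorem eqs. (5)-(6)][cite: KomaTasaki1994, §1] -/
theorem bondAvg_four_N14_U8_mem_Icc_of_lower12 {ψ : Fock (Orb (FermionTorus 2 4))}
    (hψ : IsGroundState (hamiltonian (fermionTorusGraph 2 4) 1 8) 14 ψ) (hψ1 : star ψ ⬝ᵥ ψ = 1) {E₁₂ : ℝ}
    (h₈ : torusUpper_mbbootE2_4x4_U8_N14) (hL : E₁₂ ≤ groundEnergyAt (fermionTorusGraph 2 4) 1 12 14) :
    (∑ x : FermionTorus 2 4, ∑ y : FermionTorus 2 4, ∑ σ : Fin 2,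
        if (fermionTorusGraph 2 4).Adj x y then expect (creation (orb x σ) * annihilation (orb y σ)) ψ
        else 0).re / 128 ∈
      Set.Icc (-((3 * ((-815606355579 : ℝ) / 2 ^ 36) - 2 * E₁₂) / 16) / 8) (-(-3 / 2 : ℝ) / 8) :=
  bondAvg_four_mem_Icc_of_kinetic
    ⟨kineticPerSite_four_N14_ge_free hψ.1 hψ1, kineticPerSite_four_N14_U8_le_of_lower12 hψ hψ1 h₈ hL⟩

/-- **Local-moment ceiling from a `U′ = 12` lower bound**: `m_loc ≤ 7/8 - (E₁₂ - u₈)/32` (`m_loc = n - 2d`).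
[cite: HirschPRB1985, Table II][cite: KomaTasaki1994, §1] -/
theorem localMoment_four_N14_U8_le_of_lower12 {ψ : Fock (Orb (FermionTorus 2 4))}
    (hψ : IsGroundState (hamiltonian (fermionTorusGraph 2 4) 1 8) 14 ψ) (hψ1 : star ψ ⬝ᵥ ψ = 1) {E₁₂ : ℝ}
    (h₈ : torusUpper_mbbootE2_4x4_U8_N14) (hL : E₁₂ ≤ groundEnergyAt (fermionTorusGraph 2 4) 1 12 14) :
    (expect localMomentFour ψ).re / 16 ≤ 7 / 8 - (E₁₂ - (-815606355579 : ℝ) / 2 ^ 36) / 32 := by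
  have hd := doubleOcc_four_N14_U8_ge_of_claim_of_lower12 hψ hψ1 h₈ hL
  rw [re_expect_localMomentFour hψ.1 hψ1]
  push_cast
  linarith

/-- **Fermi-surface smearing ceiling from a `U′ = 12` lower bound** (device D24 kernel `FermiSmearing`:
`W_0 = Re⟨ψ,H₀ψ⟩ + 24`): `W_0 ≤ 3u₈ - 2E₁₂ + 24`. [cite: LiebLoss2001, Theorem 1.14][cite: KomaTasaki1994, §1] -/
theorem smearing_four_N14_U8_le_of_lower12 {ψ : Fock (Orb (FermionTorus 2 4))}
    (hψ : IsGroundState (hamiltonian (fermionTorusGraph 2 4) 1 8) 14 ψ) (hψ1 : star ψ ⬝ᵥ ψ = 1) {E₁₂ : ℝ}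
    (h₈ : torusUpper_mbbootE2_4x4_U8_N14) (hL : E₁₂ ≤ groundEnergyAt (fermionTorusGraph 2 4) 1 12 14) :
    smearing 0 ψ ≤ 3 * ((-815606355579 : ℝ) / 2 ^ 36) - 2 * E₁₂ + 24 := by
  have hk := kineticPerSite_four_N14_U8_le_of_lower12 hψ hψ1 h₈ hL
  have hW := smearing_zero_four_eq hψ.1
  have hK : (expect (hamiltonian (fermionTorusGraph 2 4) 1 0) ψ).re =
      (star ψ ⬝ᵥ (hubbardTorus 2 4 1 0 *ᵥ ψ)).re := rfl
  have h1 : (star ψ ⬝ᵥ ψ).re = 1 := by rw [hψ1, Complex.one_re]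
  rw [hK] at hk
  rw [hW, h1]
  linarith

/-- **Occupation rows from a `U′ = 12` lower bound** (`N = 14`, `U = 8`): with `W := 3u₈ - 2E₁₂ + 24`,
displaced electrons `holesBelow + nAbove ≤ W/2`, `nInside ≥ 14 - W/2`, corner pair `h_Γ + n_Q ≤ W/4`.
[cite: LiebLoss2001, Theorem 1.14][cite: VarneyEtAl2009, §3] -/
theorem occupationRows_four_N14_U8_of_lower12 {ψ : Fock (Orb (FermionTorus 2 4))}
    (hψ : IsGroundState (hamiltonian (fermionTorusGraph 2 4) 1 8) 14 ψ) (hψ1 : star ψ ⬝ᵥ ψ = 1) {E₁₂ : ℝ}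
    (h₈ : torusUpper_mbbootE2_4x4_U8_N14) (hL : E₁₂ ≤ groundEnergyAt (fermionTorusGraph 2 4) 1 12 14) :
    holesBelow ψ + nAbove ψ ≤ (3 * ((-815606355579 : ℝ) / 2 ^ 36) - 2 * E₁₂ + 24) / 2 ∧
      14 - (3 * ((-815606355579 : ℝ) / 2 ^ 36) - 2 * E₁₂ + 24) / 2 ≤ nInside ψ ∧
      (∑ σ : Fin 2, (1 - occ 0 σ ψ)) + ∑ σ : Fin 2, occ cornerQ σ ψ ≤
        (3 * ((-815606355579 : ℝ) / 2 ^ 36) - 2 * E₁₂ + 24) / 4 := by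
  have hW := smearing_four_N14_U8_le_of_lower12 hψ hψ1 h₈ hL
  have ha := two_mul_dev_le_smearing_zero ψ
  have hc := four_mul_corner_le_smearing_zero ψ
  have hd := nInside_add_nAbove hψ.1
  have he := holesBelow_nonneg ψ
  have h1 : (star ψ ⬝ᵥ ψ).re = 1 := by rw [hψ1, Complex.one_re]
  simp only [h1] at hc hd
  push_cast at hd
  refine ⟨by linarith, by linarith, by linarith⟩

/-- **ILLUSTRATION ONLY** (hypothetical threshold, NOT a certificate and not a prediction): if some certificate
gave `-10 ≤ E_14(12)`, the rows would read `d ≥ 0.0291`, `k ≤ -0.9753`, `m_loc ≤ 0.8167`,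
`holesBelow + nAbove ≤ 4.1971`, `nInside ≥ 9.8029` — the constants flow by `norm_num`. [cite: KomaTasaki1994, §1] -/
theorem illustration_four_N14_U8_of_minus_ten_le {ψ : Fock (Orb (FermionTorus 2 4))}
    (hψ : IsGroundState (hamiltonian (fermionTorusGraph 2 4) 1 8) 14 ψ) (hψ1 : star ψ ⬝ᵥ ψ = 1)
    (h₈ : torusUpper_mbbootE2_4x4_U8_N14) (hL : (-10 : ℝ) ≤ groundEnergyAt (fermionTorusGraph 2 4) 1 12 14) :
    (0.0291 : ℝ) ≤ (expect (∑ x : FermionTorus 2 4, numberOp x 0 * numberOp x 1) ψ).re / 16 ∧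
      (expect (hamiltonian (fermionTorusGraph 2 4) 1 0) ψ).re / 16 ≤ -0.9753 ∧
      (expect localMomentFour ψ).re / 16 ≤ 0.8167 ∧
      holesBelow ψ + nAbove ψ ≤ 4.1971 ∧ (9.8029 : ℝ) ≤ nInside ψ := by
  have hd := doubleOcc_four_N14_U8_ge_of_claim_of_lower12 hψ hψ1 h₈ hL
  have hk := kineticPerSite_four_N14_U8_le_of_lower12 hψ hψ1 h₈ hL
  have hm := localMoment_four_N14_U8_le_of_lower12 hψ hψ1 h₈ hL
  have ho := occupationRows_four_N14_U8_of_lower12 hψ hψ1 h₈ hL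
  norm_num at hd hk hm ho
  refine ⟨le_trans (by norm_num) hd, le_trans hk (by norm_num), le_trans hm (by norm_num),
    le_trans ho.1 (by norm_num), le_trans (by norm_num) ho.2.1⟩

end Summit.HubbardSuperconductivity.HubbardLadder

end
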